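import Mathlib
import HarnessLib

/-!
# Route LogTimeThreeAnnuli — crux `DyadicCapture` (stmt-FinalStateConjecture-17488), line `registered`:
# stub `stub_dyadicSelection` (near-minimiser selection in `ℝ≥0∞` and the dyadic cover of late times)

Pure bookkeeping in `ℝ≥0∞` behind the window-freezing step of the lead's skeleton
`Cruxes/DyadicCapture/Lines/birth.lean` (consumed verbatim by `stub_freezingAssembly`). Two conjuncts.

* **Near-minimiser selection** (`dyadicSelection_exists_nearMinimiser`,
  `dyadicSelection_exists_selection_tendsto`). For `e : ℕ → ℝ → ℝ → ℝ≥0∞` and the parameter window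
  `W = {(M, a) | m₀ ≤ M ≤ m₀⁻¹, |a| ≤ χ M}` (no sign hypotheses), if the series of the windowwise infima
  `Iₙ = inf_{(M,a) ∈ W} e n M a` is finite then every `Iₙ` is finite, so (pick positive `εₙ` with
  `∑ εₙ < 1`, `ENNReal.exists_pos_sum_of_countable'`) `Iₙ < Iₙ + εₙ` and `iInf_lt_iff` produces members
  `(Mₙ, aₙ) ∈ W` with `e n Mₙ aₙ < Iₙ + εₙ`; hence `∑ₙ e n Mₙ aₙ ≤ ∑ Iₙ + ∑ εₙ < ⊤`, every term is finite
  and the tails `∑_{j} e (j+n) M_{j+n} a_{j+n}` tend to `0` (`ENNReal.tendsto_sum_nat_add`).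
* **Dyadic cover** (`dyadicSelection_exists_late_window`): if `2^(n₀+N) ≤ τ` then
  `τ ∈ [2^(n₀+n), 2^(n₀+n+1)]` for some `n ≥ N` (`exists_nat_pow_near` applied to `τ / 2^(n₀+N) ≥ 1`).

No literature facts are used; Mathlib only.
-/

-- the `Summit.FinalStateConjecture.FinalStateConjecture.…` namespace repeats the summit = sub-problem
-- segment (D-0017); deliberate.
set_option linter.dupNamespace false

noncomputable section

namespace Summit.FinalStateConjecture.FinalStateConjecture.Theorems

open scoped Topology ENNReal
open Filter Set

/-- **Near-minimiser selection with a summable total.** If the series of the windowwise infima of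
`e n · ·` over the window `m₀ ≤ M ≤ m₀⁻¹`, `|a| ≤ χ M` is finite, then there are window members
`(Mₙ, aₙ)` whose values `e n Mₙ aₙ` still have a finite series: each infimum is finite
(`ENNReal.ne_top_of_tsum_ne_top`), so it is strictly below itself plus a positive `εₙ` with `∑ εₙ < 1`
(`ENNReal.exists_pos_sum_of_countable'`, `ENNReal.lt_add_right`), and `iInf_lt_iff` (three times, for the
nested infimum) yields a member below that level; the selected series is at most `∑ Iₙ + ∑ εₙ < ⊤`.
[folklore] -/
theorem dyadicSelection_exists_nearMinimiser (e : ℕ → ℝ → ℝ → ℝ≥0∞) (m₀ χ : ℝ)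
    (h : (∑' n : ℕ, ⨅ (M : ℝ) (a : ℝ) (_ : m₀ ≤ M ∧ M ≤ m₀⁻¹ ∧ |a| ≤ χ * M), e n M a) ≠ ⊤) :
    ∃ (M a : ℕ → ℝ), (∀ n, m₀ ≤ M n ∧ M n ≤ m₀⁻¹ ∧ |a n| ≤ χ * M n) ∧
      (∑' n : ℕ, e n (M n) (a n)) ≠ ⊤ := by
  obtain ⟨ε, hεpos, hεsum⟩ := ENNReal.exists_pos_sum_of_countable' one_ne_zero ℕ
  have hsel : ∀ n : ℕ, ∃ M a : ℝ, (m₀ ≤ M ∧ M ≤ m₀⁻¹ ∧ |a| ≤ χ * M) ∧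
      e n M a < (⨅ (M : ℝ) (a : ℝ) (_ : m₀ ≤ M ∧ M ≤ m₀⁻¹ ∧ |a| ≤ χ * M), e n M a) + ε n := by
    intro n
    have hlt := ENNReal.lt_add_right (ENNReal.ne_top_of_tsum_ne_top h n) (hεpos n).ne'
    obtain ⟨M, hM⟩ := iInf_lt_iff.1 hlt
    obtain ⟨a, ha⟩ := iInf_lt_iff.1 hM
    obtain ⟨hP, hlt'⟩ := iInf_lt_iff.1 ha
    exact ⟨M, a, hP, hlt'⟩
  choose M a hP hlt using hsel
  refine ⟨M, a, hP, ?_⟩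
  refine ne_top_of_le_ne_top ?_ (ENNReal.tsum_le_tsum fun n => (hlt n).le)
  rw [ENNReal.tsum_add]
  exact ENNReal.add_ne_top.2 ⟨h, (hεsum.trans_le le_top).ne⟩

/-- **Near-minimiser selection, registered form.** Under the same finiteness hypothesis there are window
members `(Mₙ, aₙ)` with every `e n Mₙ aₙ` finite and vanishing tails
`∑ⱼ e (j+n) M_{j+n} a_{j+n} → 0` (`dyadicSelection_exists_nearMinimiser`, then
`ENNReal.ne_top_of_tsum_ne_top` and `ENNReal.tendsto_sum_nat_add`). [folklore] -/
theorem dyadicSelection_exists_selection_tendsto (e : ℕ → ℝ → ℝ → ℝ≥0∞) (m₀ χ : ℝ)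
    (h : (∑' n : ℕ, ⨅ (M : ℝ) (a : ℝ) (_ : m₀ ≤ M ∧ M ≤ m₀⁻¹ ∧ |a| ≤ χ * M), e n M a) ≠ ⊤) :
    ∃ (M a : ℕ → ℝ), (∀ n, m₀ ≤ M n ∧ M n ≤ m₀⁻¹ ∧ |a n| ≤ χ * M n) ∧ (∀ n, e n (M n) (a n) ≠ ⊤) ∧
      Filter.Tendsto (fun n => ∑' j : ℕ, e (j + n) (M (j + n)) (a (j + n))) Filter.atTop (nhds 0) := by
  obtain ⟨M, a, hP, hsum⟩ := dyadicSelection_exists_nearMinimiser e m₀ χ h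
  exact ⟨M, a, hP, ENNReal.ne_top_of_tsum_ne_top hsum,
    ENNReal.tendsto_sum_nat_add (fun n => e n (M n) (a n)) hsum⟩

/-- **Dyadic cover of late times.** If `2^(n₀+N) ≤ τ` then `τ` lies in a late closed dyadic window
`[2^(n₀+n), 2^(n₀+n+1)]` with `n ≥ N`: apply `exists_nat_pow_near` to `τ / 2^(n₀+N) ≥ 1` and base `2`
to get `2^k ≤ τ / 2^(n₀+N) < 2^(k+1)`, and take `n = N + k`. [folklore] -/
theorem dyadicSelection_exists_late_window (n₀ N : ℕ) (τ : ℝ) (hτ : (2 : ℝ) ^ (n₀ + N) ≤ τ) :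
    ∃ n : ℕ, N ≤ n ∧ τ ∈ Set.Icc ((2 : ℝ) ^ (n₀ + n)) ((2 : ℝ) ^ (n₀ + n + 1)) := by
  have hpos : (0 : ℝ) < 2 ^ (n₀ + N) := pow_pos two_pos _
  have hx : 1 ≤ τ / 2 ^ (n₀ + N) := by rwa [le_div_iff₀ hpos, one_mul]
  obtain ⟨k, hk1, hk2⟩ := exists_nat_pow_near hx one_lt_two
  rw [le_div_iff₀ hpos] at hk1
  rw [div_lt_iff₀ hpos] at hk2
  refine ⟨N + k, Nat.le_add_right N k, ?_, ?_⟩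
  · calc (2 : ℝ) ^ (n₀ + (N + k)) = 2 ^ k * 2 ^ (n₀ + N) := by ring
      _ ≤ τ := hk1
  · calc τ ≤ 2 ^ (k + 1) * 2 ^ (n₀ + N) := hk2.le
      _ = (2 : ℝ) ^ (n₀ + (N + k) + 1) := by ring

/-- **Registered stub `stub_dyadicSelection`** of the skeleton `Cruxes/DyadicCapture/Lines/birth.lean`
(signature verbatim): (i) near-minimiser selection in `ℝ≥0∞` over the compact parameter window with finite
terms and vanishing tails (`dyadicSelection_exists_selection_tendsto`); (ii) every `τ ≥ 2^(n₀+N)` lies in a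
closed dyadic window `[2^(n₀+n), 2^(n₀+n+1)]` with `n ≥ N` (`dyadicSelection_exists_late_window`).
[folklore] -/
theorem stub_dyadicSelection :
    (∀ (e : ℕ → ℝ → ℝ → ENNReal) (m₀ χ : ℝ), (∑' n : ℕ, ⨅ (M : ℝ) (a : ℝ) (_ : m₀ ≤ M ∧ M ≤ m₀⁻¹ ∧ |a| ≤ χ * M), e n M a) ≠ ⊤ → ∃ (M a : ℕ → ℝ), (∀ n, m₀ ≤ M n ∧ M n ≤ m₀⁻¹ ∧ |a n| ≤ χ * M n) ∧ (∀ n, e n (M n) (a n) ≠ ⊤) ∧ Filter.Tendsto (fun n => ∑' j : ℕ, e (j + n) (M (j + n)) (a (j + n))) Filter.atTop (nhds 0)) ∧ (∀ (n₀ N : ℕ) (τ : ℝ), (2 : ℝ) ^ (n₀ + N) ≤ τ → ∃ n : ℕ, N ≤ n ∧ τ ∈ Set.Icc ((2 : ℝ) ^ (n₀ + n)) ((2 : ℝ) ^ (n₀ + n + 1))) :=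
  ⟨dyadicSelection_exists_selection_tendsto, dyadicSelection_exists_late_window⟩

end Summit.FinalStateConjecture.FinalStateConjecture.Theorems

end
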